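import Literature.ModelTheory.ExponentialFields.SemialgebraicFreeWindowCuts
import Literature.ModelTheory.ExponentialFields.SemialgebraicCertifiedMechanisms
import HarnessLib

/-!
# Certified cuts for a free window

Topic `Literature/ModelTheory/ExponentialFields` — block B2d₂ of the proof of the
`C¹`-triangulation theorem for compact semialgebraic sets
(`Literature.ModelTheory.ExponentialFields.OhmotoShiota2017_c1Triangulation`, statement of
[OhmotoShiota2017, Thm. 1.1]) along the proof of [Pawlucki2024], specialized to `p = 1`.

The induction of block B2c₃ ([Pawlucki2024, Prop. 2.5, proof, Part II, final claim]) rerun with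
the certified bookkeeping of blocks B2d₀–B2d₁: the served neighbourhoods come with finitely many
good certificates (domains `U_B`, endpoints among `γ, δ` and the cuts) and certified validity
`CValid` (`exists_cvalid_free`).  The constructions (adapted decomposition, thin bands, thick
ladders) are those of blocks B2c₁, B2c₃.

No named facts are introduced (D-0026).

## References

* [Pawlucki2024] W. Pawłucki, *Strict `C^p`-triangulations — a new approach to
  desingularization*, J. Eur. Math. Soc. 26 (2024), 3863–3909, Prop. 2.5, proof, Part II.
* [Dries1998] L. van den Dries, *Tame topology and o-minimal structures*, Ch. 3 (2.11), Ch. 4 (1.8).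
* [OhmotoShiota2017] T. Ohmoto, M. Shiota, *`C¹`-triangulations of semialgebraic sets*,
  J. Topology 10 (2017), Thm. 1.1 (statement only).
-/

noncomputable section

open Set Filter Metric
open _root_.Topology

namespace Literature.ModelTheory.ExponentialFields

open Literature.NumberTheory.Transcendental (IsSemialgebraicFunOn IsSemialgebraicMapOn
  isSemialgebraicFunOn_iff isSemialgebraicMapOn_iff_forall_holds)

section CFreeWindow

variable {m q : ℕ}

/-- Admissible certificates for a free window and a cut family: good, with semialgebraic domain and
endpoints among `γ, δ` and the cuts. [cite: Pawlucki2024, Prop. 2.5 (proof, Part II)] -/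
def FreeWindow.CertOK (W : FreeWindow m q) (𝒞 : Finset ((Fin m → ℝ) → ℝ)) (κ : Cert m q) : Prop :=
  κ.Good W.V ∧ IsSemialgebraic ℝ κ.O ∧ (κ.lo = W.γ ∨ κ.lo = W.δ ∨ κ.lo ∈ 𝒞) ∧ (κ.hi = W.γ ∨ κ.hi = W.δ ∨ κ.hi ∈ 𝒞)

/-- `CertOK` is monotone in the cut family. [cite: Pawlucki2024, Prop. 2.5] -/
theorem FreeWindow.CertOK.mono {W : FreeWindow m q} {𝒞 𝒞' : Finset ((Fin m → ℝ) → ℝ)} {κ : Cert m q}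
    (h : W.CertOK 𝒞 κ) (h𝒞 : 𝒞 ⊆ 𝒞') : W.CertOK 𝒞' κ := by
  refine ⟨h.1, h.2.1, ?_, ?_⟩
  · rcases h.2.2.1 with h' | h' | h'
    · exact Or.inl h'
    · exact Or.inr (Or.inl h')
    · exact Or.inr (Or.inr (h𝒞 h'))
  · rcases h.2.2.2 with h' | h' | h'
    · exact Or.inl h'
    · exact Or.inr (Or.inl h')
    · exact Or.inr (Or.inr (h𝒞 h'))

/-- The certified conclusion shape: cuts, finitely many admissible certificates and an open
semialgebraic `U ⊇ A` on which (inside `Fr`) the family is certified-valid.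
[cite: Pawlucki2024, Prop. 2.5 (proof, Part II)] -/
def FreeWindow.CServes (W : FreeWindow m q) (A : Set (Fin m → ℝ)) (𝒞 : Finset ((Fin m → ℝ) → ℝ))
    (𝒦 : Set (Cert m q)) (U : Set (Fin m → ℝ)) : Prop :=
  (∀ c ∈ 𝒞, Continuous c ∧ IsSemialgebraicFunOn ℝ univ c) ∧ 𝒦.Finite ∧ (∀ κ ∈ 𝒦, W.CertOK 𝒞 κ) ∧
    IsOpen U ∧ IsSemialgebraic ℝ U ∧ A ⊆ U ∧ ∀ x ∈ U ∩ W.Fr, CValid W.γ W.δ 𝒞 𝒦 x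

namespace FreeWindow

variable {W : FreeWindow m q} (H : W.Hyp)
include H

omit H in
open Classical in
/-- Union of two certified-served sets. [cite: Pawlucki2024, Prop. 2.5] -/
theorem CServes.union {A A' : Set (Fin m → ℝ)} {𝒞 𝒞' : Finset ((Fin m → ℝ) → ℝ)} {𝒦 𝒦' : Set (Cert m q)}
    {U U' : Set (Fin m → ℝ)} (h : W.CServes A 𝒞 𝒦 U) (h' : W.CServes A' 𝒞' 𝒦' U') :
    W.CServes (A ∪ A') (𝒞 ∪ 𝒞') (𝒦 ∪ 𝒦') (U ∪ U') := by
  classical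
  refine ⟨fun c hc => ?_, h.2.1.union h'.2.1, fun κ hκ => ?_, h.2.2.2.1.union h'.2.2.2.1,
    h.2.2.2.2.1.union h'.2.2.2.2.1, union_subset_union h.2.2.2.2.2.1 h'.2.2.2.2.2.1, fun x hx => ?_⟩
  · rcases Finset.mem_union.1 hc with hc | hc
    · exact h.1 c hc
    · exact h'.1 c hc
  · rcases hκ with hκ | hκ
    · exact (h.2.2.1 κ hκ).mono Finset.subset_union_left
    · exact (h'.2.2.1 κ hκ).mono Finset.subset_union_right
  · rcases hx.1 with hxU | hxU
    · exact (h.2.2.2.2.2.2 x ⟨hxU, hx.2⟩).mono Finset.subset_union_left subset_union_left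
    · exact (h'.2.2.2.2.2.2 x ⟨hxU, hx.2⟩).mono Finset.subset_union_right subset_union_right

omit H in
/-- The empty set is certified-served by nothing. [cite: Pawlucki2024, Prop. 2.5] -/
theorem CServes.empty : W.CServes ∅ ∅ ∅ ∅ :=
  ⟨fun _ h => absurd h (Finset.notMem_empty _), finite_empty, fun _ h => absurd h (notMem_empty _), isOpen_empty,
    isSemialgebraic_empty, empty_subset _, fun _ hx => absurd hx.1 (notMem_empty _)⟩

/-! #### The per-cell construction -/

variable {𝒯 : Finset (Set (Fin (m + 1) → ℝ))} {ℬ : Finset (Set (Fin m → ℝ))}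
  {L : Set (Fin m → ℝ) → ℕ} {ξ : (S : Set (Fin m → ℝ)) → Fin (L S) → (Fin m → ℝ) → ℝ}

/-- **Cuts near a cell** [Pawlucki2024, p. 3872, over one `B_ν`]: for a base cell `S ⊆ Fr` of a
decomposition adapted to the cover and to the graphs of `γ, δ`, and a semialgebraic `K ⊆ S` away from
the nondegenerate frontier of `S`, finitely many cuts serve a neighbourhood of `K`.
[cite: Pawlucki2024, Prop. 2.5 (proof, Part II)] -/
theorem exists_cserves_near_cell (hpart : Setoid.IsPartition (𝒯 : Set (Set (Fin (m + 1) → ℝ))))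
    (hℬ : IsCylindricalDecomposition ℝ m ℬ) (hst : IsStackOf ℬ 𝒯 L ξ)
    {𝒞V : Fin q → Finset (Set (Fin (m + 1) → ℝ))} (h𝒞V : ∀ j, 𝒞V j ⊆ 𝒯)
    (hV : ∀ j, W.V j = ⋃₀ ((𝒞V j : Finset _) : Set (Set (Fin (m + 1) → ℝ))))
    {𝒞γ 𝒞δ : Finset (Set (Fin (m + 1) → ℝ))} (h𝒞γ : 𝒞γ ⊆ 𝒯) (h𝒞δ : 𝒞δ ⊆ 𝒯)
    (hΓγ : graphOver W.Fr W.γ = ⋃₀ (𝒞γ : Set (Set (Fin (m + 1) → ℝ))))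
    (hΓδ : graphOver W.Fr W.δ = ⋃₀ (𝒞δ : Set (Set (Fin (m + 1) → ℝ))))
    {S : Set (Fin m → ℝ)} (hS : S ∈ ℬ) (hSFr : S ⊆ W.Fr)
    {K : Set (Fin m → ℝ)} (hKS : K ⊆ S) (hKsa : IsSemialgebraic ℝ K)
    (hKsep : ∀ z ∈ closure K, z ∈ closure S → z ∉ S → z ∉ W.Fr) :
    ∃ 𝒞 𝒦 U, W.CServes K 𝒞 𝒦 U := by
  classical
  rcases K.eq_empty_or_nonempty with rfl | hKne
  · exact ⟨∅, ∅, ∅, CServes.empty⟩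
  obtain ⟨hc, hs, hmono, hcells⟩ := hst
  have hℬpart := hℬ.isPartition
  have hSsa : IsSemialgebraic ℝ S := hℬ.isSemialgebraic S hS
  -- the sections `γ = ξ jγ`, `δ = ξ jδ` over `S`
  obtain ⟨jγ, hjγ⟩ := exists_section_eq hℬpart ⟨hc, hs, hmono, hcells⟩ h𝒞γ hΓγ hS hSFr
  obtain ⟨jδ, hjδ⟩ := exists_section_eq hℬpart ⟨hc, hs, hmono, hcells⟩ h𝒞δ hΓδ hS hSFr
  obtain ⟨x₀, hx₀⟩ := hKne
  have hx₀S := hKS hx₀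
  have hjlt : jγ < jδ := by
    by_contra hle
    have h := (hmono S hS x₀ hx₀S).monotone (not_lt.1 hle)
    rw [hjγ x₀ hx₀S, hjδ x₀ hx₀S] at h
    exact absurd (H.γ_lt_δ x₀ (hSFr hx₀S)) (not_lt.2 h)
  -- a default cover index
  obtain ⟨j₀, -⟩ := H.cover x₀ (hSFr hx₀S) (W.γ x₀) ⟨le_rfl, (H.γ_lt_δ x₀ (hSFr hx₀S)).le⟩
  -- the sections as an `ℕ`-indexed family
  set p : ℕ := (jδ : ℕ) - jγ with hp
  have hp_pos : 0 < p := by rw [hp]; exact Nat.sub_pos_of_lt hjlt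
  have hidx : ∀ i ≤ p, (jγ : ℕ) + i < L S := fun i hi => by
    have := jδ.2; omega
  set φ : ℕ → (Fin m → ℝ) → ℝ := fun i x => if h : (jγ : ℕ) + i < L S then ξ S ⟨jγ + i, h⟩ x else W.δ x with hφ
  have hφ_eq : ∀ i (hi : i ≤ p) x, φ i x = ξ S ⟨jγ + i, hidx i hi⟩ x := fun i hi x => by
    simp only [hφ, dif_pos (hidx i hi)]
  have hφ0 : ∀ x ∈ S, φ 0 x = W.γ x := fun x hx => by
    rw [hφ_eq 0 (Nat.zero_le _)]; simpa using hjγ x hx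
  have hφp : ∀ x ∈ S, φ p x = W.δ x := fun x hx => by
    rw [hφ_eq p le_rfl]
    have : (⟨(jγ : ℕ) + p, hidx p le_rfl⟩ : Fin (L S)) = jδ := by ext; simp [hp]; omega
    rw [this]; exact hjδ x hx
  have hφc : ∀ i ≤ p, ContinuousOn (φ i) S := fun i hi =>
    (hc S hS _).congr fun x _ => hφ_eq i hi x
  have hφs : ∀ i ≤ p, IsSemialgebraicFunOn ℝ S (φ i) := fun i hi =>
    (hs S hS _).congr fun x _ => (hφ_eq i hi x).symm
  have hφlt : ∀ x ∈ S, ∀ i < p, φ i x < φ (i + 1) x := fun x hx i hi => by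
    rw [hφ_eq i hi.le, hφ_eq (i + 1) hi]
    exact hmono S hS x hx (Fin.mk_lt_mk.2 (by omega))
  have hφmono : ∀ x ∈ S, ∀ i j, i ≤ j → j ≤ p → φ i x ≤ φ j x := fun x hx i j hij hj => by
    rw [hφ_eq i (hij.trans hj), hφ_eq j hj]
    exact (hmono S hS x hx).monotone (Fin.mk_le_mk.2 (by omega))
  have hφwin : ∀ i ≤ p, ∀ x ∈ S, φ i x ∈ Icc (W.γ x) (W.δ x) := fun i hi x hx =>
    ⟨by rw [← hφ0 x hx]; exact hφmono x hx 0 i (Nat.zero_le _) hi,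
     by rw [← hφp x hx]; exact hφmono x hx i p hi le_rfl⟩
  -- graphs inside single members of the cover
  have hgraph : ∀ i ≤ p, ∃ j, ∀ x ∈ S, (Fin.snoc x (φ i x) : Fin (m + 1) → ℝ) ∈ W.V j := by
    intro i hi
    obtain ⟨j, hj⟩ := H.cover x₀ (hSFr hx₀S) (φ i x₀) (hφwin i hi x₀ hx₀S)
    have hT : graphOver S (ξ S ⟨jγ + i, hidx i hi⟩) ∈ 𝒯 := (hcells _).2 ⟨S, hS, Or.inl ⟨_, rfl⟩⟩
    have hz : (Fin.snoc x₀ (φ i x₀) : Fin (m + 1) → ℝ) ∈ graphOver S (ξ S ⟨jγ + i, hidx i hi⟩) := by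
      rw [snoc_mem_graphOver_iff]; exact ⟨hx₀S, hφ_eq i hi x₀⟩
    have hsub := exists_cell_subset_V hpart h𝒞V hV hT hz hj
    refine ⟨j, fun x hx => hsub ?_⟩
    rw [snoc_mem_graphOver_iff]; exact ⟨hx, hφ_eq i hi x⟩
  -- bands inside single members of the cover
  have hband : ∀ i < p, ∃ j, ∀ x ∈ S, ∀ t ∈ Ioo (φ i x) (φ (i + 1) x), (Fin.snoc x t : Fin (m + 1) → ℝ) ∈ W.V j := by
    intro i hi
    set jb : Fin (L S + 1) := ⟨jγ + i + 1, by have := hidx (i + 1) hi; omega⟩ with hjb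
    have hjb0 : jb ≠ 0 := by
      rw [Ne, Fin.ext_iff]; simp [hjb]
    have hjbl : jb ≠ Fin.last (L S) := by
      have := hidx (i + 1) hi
      rw [Ne, Fin.ext_iff]; simp only [hjb, Fin.val_last]; omega
    have hpred : ∀ x, ξ S (jb.pred hjb0) x = φ i x := fun x => by
      rw [hφ_eq i hi.le]; congr 1
    have hcast : ∀ x, ξ S (jb.castPred hjbl) x = φ (i + 1) x := fun x => by
      rw [hφ_eq (i + 1) hi]; congr 1
    have hT : bandOver S (ξ S) jb ∈ 𝒯 := (hcells _).2 ⟨S, hS, Or.inr ⟨jb, rfl⟩⟩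
    have hmemT : ∀ x ∈ S, ∀ t ∈ Ioo (φ i x) (φ (i + 1) x), (Fin.snoc x t : Fin (m + 1) → ℝ) ∈ bandOver S (ξ S) jb := by
      intro x hx t ht
      rw [snoc_mem_bandOver_iff_of_ne hjb0 hjbl, hpred, hcast]
      exact ⟨hx, ht⟩
    -- the midpoint over `x₀` is covered
    set t₀ := (φ i x₀ + φ (i + 1) x₀) / 2 with ht₀
    have hlt₀ := hφlt x₀ hx₀S i hi
    have ht₀mem : t₀ ∈ Ioo (φ i x₀) (φ (i + 1) x₀) := ⟨by rw [ht₀]; linarith, by rw [ht₀]; linarith⟩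
    obtain ⟨j, hj⟩ := H.cover x₀ (hSFr hx₀S) t₀
      ⟨(hφwin i hi.le x₀ hx₀S).1.trans ht₀mem.1.le, ht₀mem.2.le.trans (hφwin (i + 1) hi x₀ hx₀S).2⟩
    have hsub := exists_cell_subset_V hpart h𝒞V hV hT (hmemT x₀ hx₀S t₀ ht₀mem) hj
    exact ⟨j, fun x hx t ht => hsub (hmemT x hx t ht)⟩
  haveI : Nonempty (Fin q) := ⟨j₀⟩
  choose! gsel hgsel using hgraph
  choose! bsel hbsel using hband
  set g : ℕ → Fin q := fun i => if i ≤ p then gsel i else j₀ with hg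
  set bnd : ℕ → Fin q := fun i => if i < p then bsel i else j₀ with hbnd
  have hg' : ∀ i ≤ p, ∀ x ∈ S, (Fin.snoc x (φ i x) : Fin (m + 1) → ℝ) ∈ W.V (g i) := fun i hi x hx => by
    simp only [hg, if_pos hi]; exact hgsel i hi x hx
  have hbnd' : ∀ i < p, ∀ x ∈ S, ∀ t ∈ Ioo (φ i x) (φ (i + 1) x), (Fin.snoc x t : Fin (m + 1) → ℝ) ∈ W.V (bnd i) :=
    fun i hi x hx t ht => by simp only [hbnd, if_pos hi]; exact hbsel i hi x hx t ht
  -- the chart of the cell `S`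
  obtain ⟨d, hcell⟩ := IsCylindricalDecomposition.exists_isSACell (k := ℝ) hℬ S hS
  obtain ⟨ι, U, φc, -, hU, hUeq, hφcc, hφcs, hleft, hright⟩ := hcell.exists_chart
  -- the ladder data
  set Ld : LadderData m d q :=
    { B := S, ι := ι, U := U, φ := φc, V := W.V, jb := tlJb g bnd, γ := W.γ, δ := W.δ,
      ψ := tlPsi W.V φ p g, M := 2 * p + 1, Fr := W.Fr, K := K } with hLd
  have HL : Ld.Hyp :=
    { B_bdd := H.Fr_bdd.subset hSFr
      isOpen_U := hU.isOpen rfl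
      chart_left := hleft
      chart_mem := fun x hx => by show x ∘ ι ∈ U; rw [hUeq]; exact ⟨x, hx, rfl⟩
      chart_right := hright
      φ_cont := hφcc
      isOpen_V := H.isOpen_V
      γ_cont := H.γ_cont
      δ_cont := H.δ_cont
      ψ_cont := fun ν => continuousOn_tlPsi hφc ν
      ψ_zero := fun y hy => by show tlPsi W.V φ p g 0 y = W.γ y; rw [tlPsi_zero, hφ0 y hy]
      ψ_top := fun y hy ν hν => by show tlPsi W.V φ p g ν y = W.δ y; rw [tlPsi_top hν, hφp y hy]
      ψ_lt := fun y hy ν hν => tlPsi_lt H.isOpen_V hp_pos hφlt hg' hy hν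
      M_pos := Nat.succ_pos _
      piece := fun ν hν y hy t ht => tlPsi_piece H.isOpen_V hp_pos hφlt hg' hbnd' hν hy ht
      B_sub := hSFr
      pinch := H.pinch
      K_sub := hKS
      K_sep := hKsep
      K_ne := ⟨x₀, hx₀⟩ }
  have SL : Ld.SA :=
    { chart := ⟨hSsa, hU.isSemialgebraic, hφcs⟩
      V_sa := H.V_sa
      γ_sa := H.γ_sa
      δ_sa := H.δ_sa
      ψ_sa := fun ν => tlPsi_sa H.V_sa hSsa hφs ν
      Fr_sa := H.Fr_sa
      K_sa := hKsa }
  obtain ⟨c, U', 𝒦, hcc, hcs, hUo, hUs, hKU, hfin, hOK, hval⟩ := LadderData.exists_thick_certs HL SL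
  refine ⟨Finset.univ.image c, 𝒦, U', fun c' hc' => ?_, hfin, fun κ hκ => ?_, hUo, hUs, hKU, fun x hx => hval x hx.1⟩
  · obtain ⟨i, -, rfl⟩ := Finset.mem_image.1 hc'
    exact ⟨hcc i, hcs i⟩
  · obtain ⟨hg, hO, hlo, hhi⟩ := hOK κ hκ
    refine ⟨hg, hO, ?_, ?_⟩
    · rcases hlo with h | h | ⟨i, h⟩
      · exact Or.inl h
      · exact Or.inr (Or.inl h)
      · exact Or.inr (Or.inr (Finset.mem_image.2 ⟨i, Finset.mem_univ _, h.symm⟩))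
    · rcases hhi with h | h | ⟨i, h⟩
      · exact Or.inl h
      · exact Or.inr (Or.inl h)
      · exact Or.inr (Or.inr (Finset.mem_image.2 ⟨i, Finset.mem_univ _, h.symm⟩))

/-! #### The induction on the dimension of the served set -/

open Classical in
/-- **The final claim of the proof of Prop. 2.5, by induction on `dim A`** [Pawlucki2024, p. 3872,
"We proceed again by induction on `k`"]: every semialgebraic `A ⊆ Fr` is served.
[cite: Pawlucki2024, Prop. 2.5 (proof, Part II)] -/
theorem exists_cserves : ∀ (d : ℕ) (A : Set (Fin m → ℝ)), A ⊆ W.Fr → IsSemialgebraic ℝ A → sdim A ≤ d →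
    ∃ 𝒞 𝒦 U, W.CServes A 𝒞 𝒦 U := by
  intro d
  induction d using Nat.strong_induction_on with
  | _ d IH =>
  intro A hAFr hAs hAd
  -- the adapted cylindrical decomposition of `ℝ^{m+1}`
  set cylA : Set (Fin (m + 1) → ℝ) := {z | Fin.init z ∈ A} with hcylA
  set cylFr : Set (Fin (m + 1) → ℝ) := {z | Fin.init z ∈ W.Fr} with hcylFr
  set 𝓕 : Finset (Set (Fin (m + 1) → ℝ)) :=
    (Finset.univ.image W.V) ∪ {graphOver W.Fr W.γ, graphOver W.Fr W.δ, cylA, cylFr} with h𝓕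
  have hΓγsa : IsSemialgebraic ℝ (graphOver W.Fr W.γ) :=
    isSemialgebraicFunOn_iff.mp (H.γ_sa.mono (subset_univ _) H.Fr_sa)
  have hΓδsa : IsSemialgebraic ℝ (graphOver W.Fr W.δ) :=
    isSemialgebraicFunOn_iff.mp (H.δ_sa.mono (subset_univ _) H.Fr_sa)
  have h𝓕sa : ∀ s ∈ 𝓕, IsSemialgebraic ℝ s := by
    intro s hs
    rcases Finset.mem_union.1 hs with hs | hs
    · obtain ⟨j, -, rfl⟩ := Finset.mem_image.1 hs; exact H.V_sa j
    · simp only [Finset.mem_insert, Finset.mem_singleton] at hs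
      rcases hs with rfl | rfl | rfl | rfl
      · exact hΓγsa
      · exact hΓδsa
      · exact hAs.setOf_init_mem
      · exact H.Fr_sa.setOf_init_mem
  obtain ⟨𝒯, h𝒯, hadapt⟩ := IsSemialgebraic.exists_cylindricalDecomposition_holds (k := ℝ) 𝓕 h𝓕sa
  rw [isCylindricalDecomposition_succ] at h𝒯
  obtain ⟨hpart, -, ℬ, hℬ, L, ξ, hc, hs, hmono, hcells⟩ := h𝒯
  have hst : IsStackOf ℬ 𝒯 L ξ := ⟨hc, hs, hmono, hcells⟩
  have hℬpart := hℬ.isPartition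
  -- adaptedness data
  have hmem : ∀ s, s = graphOver W.Fr W.γ ∨ s = graphOver W.Fr W.δ ∨ s = cylA ∨ s = cylFr → s ∈ 𝓕 := by
    intro s hs'
    refine Finset.mem_union_right _ ?_
    simp only [Finset.mem_insert, Finset.mem_singleton]
    tauto
  have hVmem : ∀ j, W.V j ∈ 𝓕 := fun j => Finset.mem_union_left _ (Finset.mem_image.2 ⟨j, Finset.mem_univ _, rfl⟩)
  choose 𝒞V h𝒞V hV using fun j => hadapt (W.V j) (hVmem j)
  obtain ⟨𝒞γ, h𝒞γ, hΓγ⟩ := hadapt _ (hmem _ (Or.inl rfl))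
  obtain ⟨𝒞δ, h𝒞δ, hΓδ⟩ := hadapt _ (hmem _ (Or.inr (Or.inl rfl)))
  obtain ⟨𝒞A, h𝒞A, hcA⟩ := hadapt _ (hmem _ (Or.inr (Or.inr (Or.inl rfl))))
  obtain ⟨𝒞Fr, h𝒞Fr, hcFr⟩ := hadapt _ (hmem _ (Or.inr (Or.inr (Or.inr rfl))))
  have hAcell : ∀ S ∈ ℬ, S ⊆ A ∨ Disjoint S A := fun S hS => base_subset_or_disjoint hpart hst h𝒞A hcA.symm hS
  -- the top-dimensional cells inside `A` and the rest
  set d₀ := sdim A with hd₀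
  set 𝒮 : Finset (Set (Fin m → ℝ)) := ℬ.filter fun S => S ⊆ A ∧ sdim S = d₀ with h𝒮
  set ℛ : Finset (Set (Fin m → ℝ)) := ℬ.filter fun S => S ⊆ A ∧ sdim S ≠ d₀ with hℛ
  have hcellA : ∀ x ∈ A, ∃ S ∈ ℬ, x ∈ S ∧ S ⊆ A := by
    intro x hx
    obtain ⟨S, ⟨hS, hxS⟩, -⟩ := hℬpart.2 x
    rcases hAcell S hS with h | h
    · exact ⟨S, hS, hxS, h⟩
    · exact absurd hx (disjoint_left.1 h hxS)
  set E : Set (Fin m → ℝ) := (⋃ S ∈ ℛ, S) ∪ ⋃ S ∈ 𝒮, ((closure S \ S) ∩ W.Fr) with hE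
  have hEFr : E ⊆ W.Fr := by
    rintro x (hx | hx)
    · obtain ⟨S, hS, hxS⟩ := mem_iUnion₂.1 hx
      exact hAFr ((Finset.mem_filter.1 hS).2.1 hxS)
    · obtain ⟨S, -, hxS⟩ := mem_iUnion₂.1 hx
      exact hxS.2
  have hℬsa : ∀ S ∈ ℬ, IsSemialgebraic ℝ S := fun S hS => hℬ.isSemialgebraic S hS
  have hEsa : IsSemialgebraic ℝ E :=
    (IsSemialgebraic.biUnion _ _ fun S hS => hℬsa S (Finset.mem_filter.1 hS).1).union
      (IsSemialgebraic.biUnion _ _ fun S hS => ((isSemialgebraic_closure (hℬsa S (Finset.mem_filter.1 hS).1)).diff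
        (hℬsa S (Finset.mem_filter.1 hS).1)).inter H.Fr_sa)
  -- dimension of `E`
  have hℛdim : ∀ S ∈ ℛ, sdim S < d₀ := fun S hS => by
    obtain ⟨-, hSA, hne⟩ := Finset.mem_filter.1 hS
    exact lt_of_le_of_ne (sdim_mono hSA) hne
  have hfront : ∀ S ∈ 𝒮, (closure S \ S) ∩ W.Fr = ∅ ∨ sdim ((closure S \ S) ∩ W.Fr) < d₀ := fun S hS => by
    obtain ⟨hSℬ, -, hSd⟩ := Finset.mem_filter.1 hS
    rcases sdim_closure_diff_lt m (hℬsa S hSℬ) with h | h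
    · left; rw [h, empty_inter]
    · right; rw [← hSd]; exact (sdim_mono inter_subset_left).trans_lt h
  -- serving `E` by induction (or trivially when empty)
  have hEserv : ∃ 𝒞 𝒦 U, W.CServes E 𝒞 𝒦 U := by
    by_cases hd0 : d₀ = 0
    · -- then `E = ∅`
      have hE0 : E = ∅ := by
        apply eq_empty_of_forall_notMem
        rintro x (hx | hx)
        · obtain ⟨S, hS, -⟩ := mem_iUnion₂.1 hx
          have := hℛdim S hS; omega
        · obtain ⟨S, hS, hxS⟩ := mem_iUnion₂.1 hx
          rcases hfront S hS with h | h
          · rw [h] at hxS; exact hxS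
          · omega
      rw [hE0]; exact ⟨∅, ∅, ∅, CServes.empty⟩
    · have hd₀d : d₀ - 1 < d := by omega
      have hEdim : sdim E ≤ d₀ - 1 := by
        rw [hE, sdim_union (IsSemialgebraic.biUnion _ _ fun S hS => hℬsa S (Finset.mem_filter.1 hS).1)
          (IsSemialgebraic.biUnion _ _ fun S hS => ((isSemialgebraic_closure (hℬsa S (Finset.mem_filter.1 hS).1)).diff
            (hℬsa S (Finset.mem_filter.1 hS).1)).inter H.Fr_sa)]
        refine max_le ?_ ?_
        · exact sdim_biUnion_le _ _ (fun S hS => hℬsa S (Finset.mem_filter.1 hS).1) fun S hS => by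
            have := hℛdim S hS; omega
        · refine sdim_biUnion_le _ _ (fun S hS => ((isSemialgebraic_closure (hℬsa S (Finset.mem_filter.1 hS).1)).diff
            (hℬsa S (Finset.mem_filter.1 hS).1)).inter H.Fr_sa) fun S hS => ?_
          rcases hfront S hS with h | h
          · rw [h, sdim_empty]; exact Nat.zero_le _
          · omega
      exact IH (d₀ - 1) hd₀d E hEFr hEsa hEdim
  obtain ⟨𝒞E, 𝒦E, UE, hEserves⟩ := hEserv
  -- serving the top cells away from `U_E`
  have hcellserv : ∀ S ∈ 𝒮, ∃ 𝒞 𝒦 U, W.CServes (S \ UE) 𝒞 𝒦 U := by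
    intro S hS
    obtain ⟨hSℬ, hSA, -⟩ := Finset.mem_filter.1 hS
    refine exists_cserves_near_cell H hpart hℬ hst h𝒞V (fun j => (hV j).symm) h𝒞γ h𝒞δ hΓγ.symm hΓδ.symm hSℬ
      (hSA.trans hAFr) (fun x hx => hx.1) ((hℬsa S hSℬ).diff hEserves.2.2.2.2.1) fun z hzK hzcl hzS hzFr => ?_
    -- `z` would be a frontier point of `S` in `Fr`, hence in `E ⊆ U_E`, an open set missing `S ∖ U_E`
    have hzE : z ∈ E := Or.inr (mem_iUnion₂.2 ⟨S, hS, ⟨hzcl, hzS⟩, hzFr⟩)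
    have hzU : UE ∈ 𝓝 z := hEserves.2.2.2.1.mem_nhds (hEserves.2.2.2.2.2.1 hzE)
    obtain ⟨y, hyU, hyK⟩ := mem_closure_iff_nhds.1 hzK UE hzU
    exact hyK.2 hyU
  choose! 𝒞S 𝒦S US hSserv using hcellserv
  -- assemble
  refine ⟨𝒞E ∪ 𝒮.biUnion 𝒞S, 𝒦E ∪ ⋃ S ∈ 𝒮, 𝒦S S, UE ∪ ⋃ S ∈ 𝒮, US S, fun c hc => ?_, ?_, fun κ hκ => ?_, ?_, ?_, ?_,
    fun x hx => ?_⟩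
  · rcases Finset.mem_union.1 hc with hc | hc
    · exact hEserves.1 c hc
    · obtain ⟨S, hS, hcS⟩ := Finset.mem_biUnion.1 hc
      exact (hSserv S hS).1 c hcS
  · exact hEserves.2.1.union (Set.Finite.biUnion 𝒮.finite_toSet fun S hS => (hSserv S hS).2.1)
  · rcases hκ with hκ | hκ
    · exact (hEserves.2.2.1 κ hκ).mono Finset.subset_union_left
    · obtain ⟨S, hS, hκS⟩ := mem_iUnion₂.1 hκ
      exact ((hSserv S hS).2.2.1 κ hκS).mono (Finset.subset_union_right.trans' (Finset.subset_biUnion_of_mem 𝒞S hS))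
  · exact hEserves.2.2.2.1.union (isOpen_biUnion fun S hS => (hSserv S hS).2.2.2.1)
  · exact hEserves.2.2.2.2.1.union (IsSemialgebraic.biUnion _ _ fun S hS => (hSserv S hS).2.2.2.2.1)
  · intro x hxA
    obtain ⟨S, hSℬ, hxS, hSA⟩ := hcellA x hxA
    by_cases hSd : sdim S = d₀
    · have hS : S ∈ 𝒮 := Finset.mem_filter.2 ⟨hSℬ, hSA, hSd⟩
      by_cases hxU : x ∈ UE
      · exact Or.inl hxU
      · exact Or.inr (mem_iUnion₂.2 ⟨S, hS, (hSserv S hS).2.2.2.2.2.1 ⟨hxS, hxU⟩⟩)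
    · have hS : S ∈ ℛ := Finset.mem_filter.2 ⟨hSℬ, hSA, hSd⟩
      exact Or.inl (hEserves.2.2.2.2.2.1 (Or.inl (mem_iUnion₂.2 ⟨S, hS, hxS⟩)))
  · rcases hx.1 with hxU | hxU
    · exact (hEserves.2.2.2.2.2.2 x ⟨hxU, hx.2⟩).mono Finset.subset_union_left subset_union_left
    · obtain ⟨S, hS, hxS⟩ := mem_iUnion₂.1 hxU
      exact ((hSserv S hS).2.2.2.2.2.2 x ⟨hxS, hx.2⟩).mono
        (Finset.subset_union_right.trans' (Finset.subset_biUnion_of_mem 𝒞S hS))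
        (subset_union_right.trans' (subset_iUnion₂ (s := fun S _ => 𝒦S S) S hS))

/-- **Certified cuts for a free window** [Pawlucki2024, Prop. 2.5, proof, Part II]: finitely many
continuous semialgebraic cuts and admissible certificates, certified-valid for the window `(γ, δ)`
at every point of the free base. [cite: Pawlucki2024, Prop. 2.5 (proof, Part II)] -/
theorem exists_cvalid_free : ∃ (𝒞 : Finset ((Fin m → ℝ) → ℝ)) (𝒦 : Set (Cert m q)),
    (∀ c ∈ 𝒞, Continuous c ∧ IsSemialgebraicFunOn ℝ univ c) ∧ 𝒦.Finite ∧ (∀ κ ∈ 𝒦, W.CertOK 𝒞 κ) ∧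
      ∀ x ∈ W.Fr, CValid W.γ W.δ 𝒞 𝒦 x := by
  obtain ⟨𝒞, 𝒦, U, h𝒞, hfin, hOK, -, -, hFrU, hval⟩ := exists_cserves H m W.Fr subset_rfl H.Fr_sa (sdim_le _)
  exact ⟨𝒞, 𝒦, h𝒞, hfin, hOK, fun x hx => hval x ⟨hFrU hx, hx⟩⟩

end FreeWindow

end CFreeWindow

end Literature.ModelTheory.ExponentialFields
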